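import Summits.BirchSwinnertonDyer.Rank1Residual.Additive.X3BranchLayerOneField
import HarnessLib

/-!
# X3, the DEGENERATE rows OFF the sub-locus: independence of layer-one units modulo cubes, certified by
# CUBIC RESIDUES (cell `bsd-eis`, seat `bsd-eis-x3` gen 7; sequel of `X3BranchLayerOneField.lean`;
# route K1 `AdditiveBranchIMC`, crux `GordTwoRankZeroOffCaseOne` — supports only)

HONEST FRAMING (cell `bsd-eis`, `run/shared/lean/pub/bsd-eis/README.md` §4): the programme's target of
record is the full Birch–Swinnerton-Dyer formula for every `E/ℚ` of analytic rank `≤ 1`; this file is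
the injectivity half of the U-side LOWER BOUND of the degenerate certificate road on the rows with a
prime `ℓ ≡ ±1 (mod 9)` in `Σ₀` (x3-MEMO-9 §2.4 (e)). THEOREMS ONLY (no `def`, no named fact, no
`sorry`); nothing is booked; no label, tier or count of record moves.

* `pow_div_three_eq_one` (Fermat: `m³x = g³`, `m, x ≠ 0` ⟹ `x^{(q−1)/3} = 1` in `𝔽_q`, `3 ∣ q − 1`),
  `three_dvd_of_pow_eq_one` (an element of order `3`), `coeffs_eq_zero_of_vandermonde` (a quadratic
  vanishing at the nodes of an invertible Vandermonde system is `0`);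
* `eq_zero_of_cube_eq_prod_layerOne` — `γ³ = ∏ P_i(θ)^{d_i}` with `γ` fixed by `Gal(ℚ̄/ℚ_1)` and a
  cubic-residue certificate (auxiliary primes `q ≡ 1 (mod 3)` with the three roots of `X³ − 3X + 1`,
  a Vandermonde inverse, `P_i(r)^{(q−1)/3} = ω^{e_i}`, a left inverse of `e` mod `3`) force `d = 0`:
  minimal denominator `mγ = G(θ)`, `m³∏P_i^{d_i} ≡ G³` modulo the cubic (`eval₂_eq_of_aeval_eq`),
  `q ∤ m` by Vandermonde + minimality, then Fermat.

References: [IrelandRosen1990] Ch. 9 §1 (cubic residue character); [Washington1997] §13.1; cell file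
`run/shared/lean/pub/bsd-eis/x3-MEMO-9.md` §2.4 (e).
-/

set_option autoImplicit false

noncomputable section

open scoped Classical AddSubgroup NumberField

namespace Summit.BirchSwinnertonDyer.Rank1Residual.Additive

open NumberField IsDedekindDomain Field WeierstrassCurve Polynomial
  Literature.NumberTheory.GaloisRepresentations
  Literature.NumberTheory.EllipticCurves
  Literature.NumberTheory.EllipticCurves.GreenbergSelmer
  Literature.NumberTheory.EllipticCurves.GreenbergVatsal2000
  Literature.NumberTheory.EllipticCurves.Rank1Residual
  Literature.NumberTheory.NumberFields
  Summit.BirchSwinnertonDyer.Rank1Residual.X2.ResidualDevissageModules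
  Summit.BirchSwinnertonDyer.Rank1Residual.X2.ResidualDevissageLine
  Summit.BirchSwinnertonDyer.Rank1Residual.Iwasawa.CyclotomicLayerOne
  KummerLineClasses KummerLayerClasses

namespace KummerLayerClasses

/-! ### §1 Tools: Kummer relations combine on a subgroup; cubic residues; the Vandermonde step -/

/-- **Cubic residues**: in `𝔽_q` with `3 ∣ q − 1`, if `m³·x = g³` with `m ≠ 0` and `x ≠ 0` then
`x^{(q−1)/3} = 1`. [cite: IrelandRosen1990, Ch. 9 §1 Prop. 9.1.2 (method)] -/
theorem pow_div_three_eq_one {q : ℕ} [hq : Fact q.Prime] (hq1 : 3 ∣ q - 1) {m x g : ZMod q}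
    (hm : m ≠ 0) (hx : x ≠ 0) (h : m ^ 3 * x = g ^ 3) : x ^ ((q - 1) / 3) = 1 := by
  have hu : x = (g * m⁻¹) ^ 3 := by
    rw [mul_pow, ← h, inv_pow]
    field_simp
  have hg0 : g * m⁻¹ ≠ 0 := by
    intro h0
    rw [h0, zero_pow three_ne_zero] at hu
    exact hx hu
  rw [hu, ← pow_mul, Nat.mul_div_cancel' hq1]
  exact ZMod.pow_card_sub_one_eq_one hg0

/-- **An element of order `3`**: `ω³ = 1`, `ω ≠ 1`, `ω^N = 1` ⟹ `3 ∣ N`. [folklore] -/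
theorem three_dvd_of_pow_eq_one {M : Type*} [Monoid M] {ω : M} (h3 : ω ^ 3 = 1) (h1 : ω ≠ 1) {N : ℕ}
    (hN : ω ^ N = 1) : 3 ∣ N := by
  have hord : orderOf ω = 3 := orderOf_eq_prime h3 h1
  rw [← hord]
  exact orderOf_dvd_of_pow_eq_one hN

/-- **The Vandermonde step**: a polynomial of degree `≤ 2` over `𝔽_q` vanishing at the three nodes of
an invertible Vandermonde system is zero. [folklore] -/
theorem coeffs_eq_zero_of_vandermonde {q : ℕ} (r : Fin 3 → ZMod q) (w : Fin 3 → Fin 3 → ZMod q)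
    (hw : ∀ c c' : Fin 3, ∑ k, w c k * r k ^ c'.val = if c = c' then 1 else 0)
    (g : Fin 3 → ZMod q) (hg : ∀ k, ∑ c, g c * r k ^ c.val = 0) : ∀ c, g c = 0 := by
  intro c
  have key : ∑ k, w c k * (∑ c', g c' * r k ^ c'.val) = g c := by
    calc ∑ k, w c k * (∑ c', g c' * r k ^ c'.val)
        = ∑ c', (∑ k, w c k * r k ^ c'.val) * g c' := by
          simp_rw [Finset.mul_sum, Finset.sum_mul]
          rw [Finset.sum_comm]
          exact Finset.sum_congr rfl fun c' _ ↦ Finset.sum_congr rfl fun k _ ↦ by ring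
      _ = ∑ c', (if c = c' then 1 else 0) * g c' := by simp_rw [hw]
      _ = g c := by simp
  rw [← key]
  simp [hg]

/-- **Independence of layer-one units modulo cubes, by cubic residues.** `θ = ζ + ζ⁸`;
`a_i = P_i(θ)` (`P_i ∈ ℤ³`); `γ ∈ ℚ̄` fixed by `κ⁻¹(3ℤ₃)` with `γ³ = ∏ a_i^{d_i}` (`d ∈ 𝔽₃^ι`); and the
certificate: primes `q_ρ ≡ 1 (mod 3)` with roots `r_{ρ,0..2}` of the cubic and a Vandermonde inverse
`w_ρ`, `ω_ρ` of order `3`, `P_i(r_{ρ,0})^{(q_ρ−1)/3} = ω_ρ^{e_{ρ,i}}`, `P_i(r_{ρ,0}) ≠ 0`, `L` a left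
inverse of `e` mod `3`. THEN `d = 0`: writing `mγ = G(θ)` with `m` minimal, `m³∏P_i^{d_i} ≡ G³`
modulo the cubic gives, at each root mod `q_ρ`, `q_ρ ∤ m` (Vandermonde + minimality) and then
`Σ_i e_{ρ,i} d_i ≡ 0 (mod 3)` (Fermat), whence `d = L·(e·d) = 0`.
[cite: IrelandRosen1990, Ch. 9 §1 (cubic residue character)] [cite: Washington1997, §13.1] -/
theorem eq_zero_of_cube_eq_prod_layerOne {κ : ZpExtension ℚ 3} (hκ : κ.IsCyclotomic)
    {ζ : AlgebraicClosure ℚ} (hζ : IsPrimitiveRoot ζ 9) {ι : Type} [Fintype ι] [DecidableEq ι]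
    (P : ι → Fin 3 → ℤ) {d : ι → ZMod 3} {γ : AlgebraicClosure ℚ}
    (hγ : γ ^ 3 = ∏ i, ((P i 0 : AlgebraicClosure ℚ) + P i 1 * (ζ + ζ ^ 8) + P i 2 * (ζ + ζ ^ 8) ^ 2) ^ (d i).val)
    (hγG : ∀ σ ∈ κ.layerSubgroup 1, σ • γ = γ)
    {R : ℕ} (q : Fin R → ℕ) (hq : ∀ ρ, (q ρ).Prime) (hq1 : ∀ ρ, 3 ∣ q ρ - 1)
    (r : (ρ : Fin R) → Fin 3 → ZMod (q ρ)) (hr : ∀ ρ kk, r ρ kk ^ 3 - 3 * r ρ kk + 1 = 0)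
    (w : (ρ : Fin R) → Fin 3 → Fin 3 → ZMod (q ρ))
    (hw : ∀ ρ (c c' : Fin 3), ∑ kk, w ρ c kk * r ρ kk ^ c'.val = if c = c' then 1 else 0)
    (ω : (ρ : Fin R) → ZMod (q ρ)) (hω : ∀ ρ, ω ρ ^ 3 = 1 ∧ ω ρ ≠ 1)
    (e : Fin R → ι → ℕ)
    (he : ∀ ρ i, ((P i 0 : ZMod (q ρ)) + (P i 1 : ZMod (q ρ)) * r ρ 0 +
      (P i 2 : ZMod (q ρ)) * r ρ 0 ^ 2) ^ ((q ρ - 1) / 3) = ω ρ ^ e ρ i)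
    (hnz : ∀ ρ i, (P i 0 : ZMod (q ρ)) + (P i 1 : ZMod (q ρ)) * r ρ 0 +
      (P i 2 : ZMod (q ρ)) * r ρ 0 ^ 2 ≠ 0)
    (L : ι → Fin R → ℤ)
    (hL : ∀ i i', (∑ ρ, (L i ρ : ZMod 3) * (e ρ i' : ZMod 3)) = if i = i' then 1 else 0) :
    d = 0 := by
  haveI : ∀ ρ, Fact (q ρ).Prime := fun ρ ↦ ⟨hq ρ⟩
  set θ : AlgebraicClosure ℚ := ζ + ζ ^ 8 with hθdef
  have hθ : θ ^ 3 = 3 * θ - 1 := by linear_combination theta_cubic hζ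
  set a : ι → AlgebraicClosure ℚ := fun i ↦ (P i 0 : AlgebraicClosure ℚ) + P i 1 * θ + P i 2 * θ ^ 2
    with hadef
  set A : AlgebraicClosure ℚ := ∏ i, a i ^ (d i).val with hA
  have hγA : γ ^ 3 = A := hγ
  -- `m γ = G(θ)`, `m` minimal
  have hex : ∃ m : ℕ, 0 < m ∧ ∃ g₀ g₁ g₂ : ℤ,
      (m : AlgebraicClosure ℚ) * γ = g₀ + g₁ * θ + g₂ * θ ^ 2 := by
    obtain ⟨m, g₀, g₁, g₂, hm, h⟩ := exists_intCombination_of_fixed hκ hζ hγG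
    exact ⟨m, hm, g₀, g₁, g₂, h⟩
  set m := Nat.find hex with hmdef
  obtain ⟨hm0, g₀, g₁, g₂, hmγ⟩ := Nat.find_spec hex
  rw [← hmdef] at hm0 hmγ
  have hmin : ∀ m' : ℕ, m' < m → ¬ (0 < m' ∧ ∃ g₀ g₁ g₂ : ℤ,
      (m' : AlgebraicClosure ℚ) * γ = g₀ + g₁ * θ + g₂ * θ ^ 2) := fun m' hm' ↦ Nat.find_min hex hm'
  -- the polynomial identity `m³ ∏ P_i^{d_i} ≡ G³` in `ℤ[X]` modulo the cubic, through `θ`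
  set Pp : ι → ℤ[X] := fun i ↦ C (P i 2) * X ^ 2 + C (P i 1) * X + C (P i 0) with hPp
  set Gp : ℤ[X] := C g₂ * X ^ 2 + C g₁ * X + C g₀ with hGp
  have haevalP : ∀ i, aeval θ (Pp i) = a i := fun i ↦ by
    simp only [hPp, map_add, map_mul, map_pow, aeval_X, aeval_C]
    simp only [eq_intCast]
    change _ = (P i 0 : AlgebraicClosure ℚ) + P i 1 * θ + P i 2 * θ ^ 2
    ring
  have haevalG : aeval θ Gp = (m : AlgebraicClosure ℚ) * γ := by
    simp only [hGp, map_add, map_mul, map_pow, aeval_X, aeval_C]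
    simp only [eq_intCast]
    rw [hmγ]; ring
  have hident : aeval θ (((m : ℕ) : ℤ[X]) ^ 3 * ∏ i, Pp i ^ (d i).val) = aeval θ (Gp ^ 3) := by
    rw [map_mul, map_pow, map_pow, map_natCast, haevalG, map_prod]
    simp_rw [map_pow, haevalP]
    rw [← hA, ← hγA]; ring
  -- transfer to `𝔽_q` at a root `r`
  have htransfer : ∀ ρ (kk : Fin 3), ((m : ZMod (q ρ))) ^ 3 *
      ∏ i, ((P i 0 : ZMod (q ρ)) + (P i 1 : ZMod (q ρ)) * r ρ kk + (P i 2 : ZMod (q ρ)) * r ρ kk ^ 2)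
        ^ (d i).val =
      ((g₀ : ZMod (q ρ)) + (g₁ : ZMod (q ρ)) * r ρ kk + (g₂ : ZMod (q ρ)) * r ρ kk ^ 2) ^ 3 := by
    intro ρ kk
    have e := eval₂_eq_of_aeval_eq hθ hident (r ρ kk) (hr ρ kk)
    simp only [eval₂_mul, eval₂_finsetProd, eval₂_pow, eval₂_natCast, hPp, hGp, eval₂_add, eval₂_C,
      eval₂_X] at e
    simp only [eq_intCast] at e
    have hP' : ∀ i, ((P i 2 : ZMod (q ρ)) * r ρ kk ^ 2 + (P i 1 : ZMod (q ρ)) * r ρ kk + (P i 0 : ZMod (q ρ))) =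
        (P i 0 : ZMod (q ρ)) + (P i 1 : ZMod (q ρ)) * r ρ kk + (P i 2 : ZMod (q ρ)) * r ρ kk ^ 2 :=
      fun i ↦ by ring
    simp only [hP'] at e
    linear_combination e
  -- `q ∤ m`
  have hqm : ∀ ρ, ((m : ZMod (q ρ))) ≠ 0 := by
    intro ρ hm0'
    -- `G(r_kk) = 0` at the three roots
    have hG0 : ∀ kk : Fin 3, (g₀ : ZMod (q ρ)) + (g₁ : ZMod (q ρ)) * r ρ kk + (g₂ : ZMod (q ρ)) * r ρ kk ^ 2 = 0 := by
      intro kk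
      have e := htransfer ρ kk
      rw [hm0', zero_pow three_ne_zero, zero_mul] at e
      exact pow_eq_zero_iff three_ne_zero |>.mp e.symm
    -- Vandermonde ⟹ `q ∣ g_c`
    have hg : ∀ c : Fin 3, (![g₀, g₁, g₂] c : ZMod (q ρ)) = 0 := by
      refine coeffs_eq_zero_of_vandermonde (r ρ) (w ρ) (hw ρ) (fun c ↦ (![g₀, g₁, g₂] c : ZMod (q ρ))) ?_
      intro kk
      rw [Fin.sum_univ_three]
      simp only [Matrix.cons_val_zero, Matrix.cons_val_one, Matrix.head_cons, Matrix.cons_val_two,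
        Matrix.tail_cons, Fin.val_zero, Fin.val_one, Fin.val_two, pow_zero, pow_one, mul_one]
      rw [← hG0 kk]
    have hq0 : (q ρ : ZMod (q ρ)) = 0 := ZMod.natCast_self _
    have hdvd : ∀ c : Fin 3, (q ρ : ℤ) ∣ ![g₀, g₁, g₂] c := fun c ↦
      (ZMod.intCast_zmod_eq_zero_iff_dvd _ _).mp (hg c)
    have hdvdm : (q ρ : ℕ) ∣ m := (ZMod.natCast_eq_zero_iff _ _).mp hm0'
    obtain ⟨g₀', hg₀'⟩ := hdvd 0
    obtain ⟨g₁', hg₁'⟩ := hdvd 1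
    obtain ⟨g₂', hg₂'⟩ := hdvd 2
    obtain ⟨m', hm'⟩ := hdvdm
    simp only [Matrix.cons_val_zero, Matrix.cons_val_one, Matrix.head_cons, Matrix.cons_val_two,
      Matrix.tail_cons] at hg₀' hg₁' hg₂'
    have hqpos : 0 < q ρ := (hq ρ).pos
    have hm'pos : 0 < m' := by
      rcases Nat.eq_zero_or_pos m' with h | h
      · rw [h, mul_zero] at hm'; omega
      · exact h
    have hm'lt : m' < m := by
      have : 2 ≤ q ρ := (hq ρ).two_le
      nlinarith
    refine hmin m' hm'lt ⟨hm'pos, g₀', g₁', g₂', ?_⟩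
    have hqne : ((q ρ : ℕ) : AlgebraicClosure ℚ) ≠ 0 := by exact_mod_cast (hq ρ).ne_zero
    apply mul_left_cancel₀ hqne
    have e := hmγ
    rw [hm', hg₀', hg₁', hg₂'] at e
    push_cast at e ⊢
    linear_combination e
  -- cubic residues: `Σ_i e_{ρ,i} d_i ≡ 0 (mod 3)`
  have hrel : ∀ ρ, (∑ i, (e ρ i : ZMod 3) * d i) = 0 := by
    intro ρ
    set x : ZMod (q ρ) := ∏ i, ((P i 0 : ZMod (q ρ)) + (P i 1 : ZMod (q ρ)) * r ρ 0 +
      (P i 2 : ZMod (q ρ)) * r ρ 0 ^ 2) ^ (d i).val with hx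
    have hx0 : x ≠ 0 := Finset.prod_ne_zero_iff.mpr fun i _ ↦ pow_ne_zero _ (hnz ρ i)
    have h1 : x ^ ((q ρ - 1) / 3) = 1 := pow_div_three_eq_one (hq1 ρ) (hqm ρ) hx0 (htransfer ρ 0)
    have h2 : x ^ ((q ρ - 1) / 3) = ω ρ ^ (∑ i, e ρ i * (d i).val) := by
      rw [hx, ← Finset.prod_pow, ← Finset.prod_pow_eq_pow_sum]
      refine Finset.prod_congr rfl fun i _ ↦ ?_
      rw [← pow_mul, Nat.mul_comm ((d i).val) ((q ρ - 1) / 3), pow_mul, he ρ i, ← pow_mul]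
    rw [h2] at h1
    have h3 : 3 ∣ ∑ i, e ρ i * (d i).val := three_dvd_of_pow_eq_one (hω ρ).1 (hω ρ).2 h1
    have h4 : ((∑ i, e ρ i * (d i).val : ℕ) : ZMod 3) = 0 := (ZMod.natCast_eq_zero_iff _ _).mpr h3
    push_cast at h4
    simpa only [ZMod.natCast_val, ZMod.cast_id', id_eq] using h4
  -- the left inverse finishes
  funext i
  calc d i = ∑ i', (if i = i' then 1 else 0) * d i' := by simp
    _ = ∑ i', (∑ ρ, (L i ρ : ZMod 3) * (e ρ i' : ZMod 3)) * d i' := by simp_rw [hL]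
    _ = ∑ ρ, (L i ρ : ZMod 3) * ∑ i', (e ρ i' : ZMod 3) * d i' := by
        simp_rw [Finset.mul_sum, Finset.sum_mul]
        rw [Finset.sum_comm]
        exact Finset.sum_congr rfl fun ρ _ ↦ Finset.sum_congr rfl fun i' _ ↦ by ring
    _ = 0 := by simp [hrel]

end KummerLayerClasses

end Summit.BirchSwinnertonDyer.Rank1Residual.Additive

end
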